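import Mathlib
import HarnessLib
import Summits.NavierStokesRegularity.NavierStokesRegularity.Theorems.TypeILiouvilleGeneralizedBeltrami
import Literature.Analysis.UnboundedOperators.HeatKernelBoundedData

/-!
# TypeILiouvilleLambTail — crux (L) stmt-NavierStokesRegularity-10661 `TypeIliouvilleL`:
# THE VORTICITY OF A CLASS-P FLOW COMPARED WITH THE CALORIC EXTENSION OF A PAST VORTICITY SLICE
# (part 1 of the Lamb-tail budget: comparison lemma and flattening of the free part)

Helper for stmt-NavierStokesRegularity-10661 (`--supports`); theorems only, no definitions, no named-fact
hypotheses; closes no item; Navier–Stokes regularity is NOT proved here (leafhand seat of the EulerZoomLiouville route;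
sequel to `TypeILiouvilleGeneralizedBeltrami`, which it quantifies; part 2 = `TypeILiouvilleLambTailFading`).

Class P = print's class of bounded ancient mild solutions (KNSS 2009 §4 (i)): `v : ℝ → ℝ³ → ℝ³` continuous and bounded
(`‖v‖ ≤ K`) on `(−∞,0) × ℝ³`, weakly divergence free on every slice, `v(t) = e^{(t−s)Δ}v(s) − B¹_s(v,v)(t)` for
`s < t < 0`.  Write `ω = curl v` and `f = Dv[ω] − Dω[v] = curl (v × ω)` (the VORTEX COMMUTATOR = the curl of the Lamb
vector, `TypeILiouvilleGeneralizedBeltrami.curl_lamb_eq_sub`); the class-P vorticity equation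
(`TypeILiouvilleStrainLedger.classP_vorticity_eq`) is EXACTLY the forced heat equation `∂ₜω − Δω = f`.

* §0 `classP_norm_iteratedFDeriv_curl_le` — all derivatives of the vorticity slices are uniformly bounded.
* §1 `norm_curl_sub_heatExtension_curl_le` — **COMPARISON WITH THE CALORIC EXTENSION OF A PAST SLICE**: for a window
  `[s,t] ⊂ (−∞,0)` and a continuous majorant `‖f(τ,·)‖ ≤ φ τ` on it,
  `‖ω(t,x) − (e^{(t−s)Δ}ω(s))(x)‖ ≤ ∫_s^t φ`.  Mechanism: for every `‖e‖ ≤ 1` the scalar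
  `⟪e, ω − e^{(τ−s)Δ}ω(s)⟫ − ∫_s^τ φ` is a bounded subsolution of the HEAT operator on the closed slab (no drift; the
  caloric extension of the bounded `C²` slice `ω(s)` is jointly continuous up to `τ = s`, Evans §2.3.1 Thm 1, and
  solves the heat equation with the Laplacian on the data), so the tree's whole-space weak maximum principle
  `le_of_subsolution_linear_drift` applies.
* §2 `norm_heatExtension_curl_le` — **THE FREE PART FLATTENS**: `‖(e^{aΔ}ω(s))(x)‖ ≤ ‖curl‖ · 2^{3/2} a^{−1/2} K`
  (curl commutes with the caloric extension of bounded `C¹` data; sup-norm gradient estimate of `e^{aΔ}` on data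
  bounded by `K`, Giga–Giga–Saal §1.1.3).
Part 2 (`TypeILiouvilleLambTailFading`) combines §1–§2 into the Lamb-tail vorticity budget
`‖ω(t,x)‖ ≤ ‖curl‖ 2^{3/2} K (t−s)^{−1/2} + ∫_s^t φ`, derives fading vorticity ⟹ quiescence from an integrable Lamb
tail, and an unconditional Liouville cell below the strain ledger.

HONEST LABEL: classical estimates on print's class; nothing here proves a registered stub, (L), or Navier–Stokes
regularity; rung 0.
[cite: KochNadirashviliSereginSverak2009, §4 (i), Remark 6.1 (arXiv:0709.3599)]
[cite: Evans2010, §2.3.1 Thm 1 (caloric extension), §7.1.3 Thm 8 (weak maximum principle)]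
[cite: GigaGigaSaal2010, §1.1.3 (gradient estimate for `e^{tΔ}`)] [cite: MajdaBertozziCUP2002, eq. (2.110), §2.3]
-/

noncomputable section
open MeasureTheory Filter Set Function Metric
open scoped Topology ENNReal RealInnerProductSpace Laplacian ContDiff
open Literature.Analysis Literature.Analysis.FluidPDE Literature.Analysis.UnboundedOperators
set_option linter.dupNamespace false
namespace Summit.NavierStokesRegularity.NavierStokesRegularity.Theorems.TypeILiouvilleLambTail

/-! ## §0 Uniform bounds for the derivatives of the vorticity slices of a class-P flow -/

/-- Every derivative of the vorticity slices of a class-P flow is uniformly bounded on `(−∞,0) × ℝ³`: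
`‖Dᵏ(curl v(τ))(x)‖ ≤ ‖curl‖ · sup ‖Dᵏ⁺¹v‖` (KNSS 2009 §4: bounded ancient mild solutions have all derivatives
bounded; tree: `smooth_and_bounds_of_bounded_ancient_oseenMild`). [cite: KochNadirashviliSereginSverak2009, §4 (arXiv:0709.3599)] -/
theorem classP_norm_iteratedFDeriv_curl_le
    {v : ℝ → EuclideanSpace ℝ (Fin 3) → EuclideanSpace ℝ (Fin 3)}
    (hc : ContinuousOn (uncurry v) (Iio 0 ×ˢ univ))
    (hK : ∃ K : ℝ, ∀ t < 0, ∀ x, ‖v t x‖ ≤ K)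
    (hd : ∀ t < 0, IsWeaklyDivFree (v t))
    (hm : ∀ s t : ℝ, s < t → t < 0 → ∀ x,
      v t x = heatExtension (v s) (t - s) x - oseenDuhamel 1 s v v t x) (k : ℕ) :
    ∃ D : ℝ, ∀ τ < 0, ∀ x, ‖iteratedFDeriv ℝ k (curl (v τ)) x‖ ≤ D := by
  obtain ⟨K, hKb⟩ := hK
  obtain ⟨hsm', hbounds⟩ := smooth_and_bounds_of_bounded_ancient_oseenMild hc hd hm hKb
  have hsm : IsSmoothSpaceTimeOn (Iio 0) v := hsm'
  obtain ⟨C, hC⟩ := hbounds (k + 1)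
  refine ⟨‖curlCLM‖ * C, fun τ hτ x => ?_⟩
  have hvs : ContDiff ℝ ∞ (v τ) := hsm.contDiff_slice (mem_Iio.2 hτ)
  have hDv : ContDiff ℝ ∞ (fderiv ℝ (v τ)) := hvs.fderiv_right (m := ∞) (by norm_cast)
  have hcomp : curl (v τ) = curlCLM ∘ fderiv ℝ (v τ) := rfl
  rw [hcomp, ContinuousLinearMap.iteratedFDeriv_comp_left _ hDv.contDiffAt (i := k) (by exact_mod_cast le_top)]
  calc ‖curlCLM.compContinuousMultilinearMap (iteratedFDeriv ℝ k (fderiv ℝ (v τ)) x)‖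
      ≤ ‖curlCLM‖ * ‖iteratedFDeriv ℝ k (fderiv ℝ (v τ)) x‖ :=
        ContinuousLinearMap.norm_compContinuousMultilinearMap_le _ _
    _ = ‖curlCLM‖ * ‖iteratedFDeriv ℝ (k + 1) (v τ) x‖ := by rw [norm_iteratedFDeriv_fderiv]
    _ ≤ ‖curlCLM‖ * C := mul_le_mul_of_nonneg_left (hC τ hτ x) (norm_nonneg curlCLM)

/-- The Laplacian of a constant function vanishes. [folklore] -/
theorem laplacian_const (c : ℝ) (y : EuclideanSpace ℝ (Fin 3)) :
    (Δ (fun _ : EuclideanSpace ℝ (Fin 3) => c)) y = 0 := by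
  simp [InnerProductSpace.laplacian_eq_iteratedFDeriv_stdOrthonormalBasis, iteratedFDeriv_const_of_ne]


/-! ## §1 Comparison with the caloric extension of a past slice -/

/-- **COMPARISON WITH THE CALORIC EXTENSION OF A PAST SLICE.**  For a class-P flow `v`, a window `[s,t] ⊂ (−∞,0)`
and a continuous majorant `φ` of the vortex commutator on it, `‖Dv(τ)[ω(τ)](x) − Dω(τ)[v(τ)](x)‖ ≤ φ τ`
(`ω = curl v`; the commutator is `curl (v × ω)`, `TypeILiouvilleGeneralizedBeltrami.curl_lamb_eq_sub`):
`‖ω(t,x) − (e^{(t−s)Δ}ω(s))(x)‖ ≤ ∫_s^t φ`.  Proof: the class-P vorticity equation is `∂ₜω − Δω = Dv[ω] − Dω[v]`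
(`TypeILiouvilleStrainLedger.classP_vorticity_eq`), the caloric extension of the bounded `C²` slice `ω(s)` solves
the heat equation with the Laplacian on the data and is jointly continuous up to `τ = s` (Evans §2.3.1 Thm 1); hence
for `‖e‖ ≤ 1` the scalar `⟪e, ω(τ) − e^{(τ−s)Δ}ω(s)⟫ − ∫_s^τ φ` is a bounded subsolution of the heat operator on
`[s,t] × ℝ³` vanishing at `τ = s`, and the whole-space weak maximum principle (`le_of_subsolution_linear_drift`, zero
drift) makes it `≤ 0`. [cite: Evans2010, §2.3.1 Thm 1, §7.1.3 Thm 8] [cite: KochNadirashviliSereginSverak2009, §4 (i) (arXiv:0709.3599)] -/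
theorem norm_curl_sub_heatExtension_curl_le
    {v : ℝ → EuclideanSpace ℝ (Fin 3) → EuclideanSpace ℝ (Fin 3)}
    (hc : ContinuousOn (uncurry v) (Iio 0 ×ˢ univ))
    (hK : ∃ K : ℝ, ∀ t < 0, ∀ x, ‖v t x‖ ≤ K)
    (hd : ∀ t < 0, IsWeaklyDivFree (v t))
    (hm : ∀ s t : ℝ, s < t → t < 0 → ∀ x,
      v t x = heatExtension (v s) (t - s) x - oseenDuhamel 1 s v v t x)
    {s t : ℝ} (hst : s < t) (ht : t < 0) {φ : ℝ → ℝ} (hφc : Continuous φ)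
    (hφ : ∀ τ ∈ Icc s t, ∀ x : EuclideanSpace ℝ (Fin 3),
      ‖fderiv ℝ (v τ) x (curl (v τ) x) - fderiv ℝ (curl (v τ)) x (v τ x)‖ ≤ φ τ)
    (x : EuclideanSpace ℝ (Fin 3)) :
    ‖curl (v t) x - heatExtension (curl (v s)) (t - s) x‖ ≤ ∫ τ in s..t, φ τ := by
  obtain ⟨K, hKb⟩ := hK
  have hs : s < 0 := hst.trans ht
  have hIcc : Icc s t ⊆ Iio 0 := fun τ hτ => lt_of_le_of_lt hτ.2 ht
  obtain ⟨hsm', -⟩ := smooth_and_bounds_of_bounded_ancient_oseenMild hc hd hm hKb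
  have hsm : IsSmoothSpaceTimeOn (Iio 0) v := hsm'
  have hvort : IsSmoothSpaceTimeOn (Iio 0) (vorticity v) := isSmoothSpaceTimeOn_vorticity_Iio hsm
  -- uniform bounds on the vorticity slices and their first two derivatives
  obtain ⟨D₀, hD₀⟩ := classP_norm_iteratedFDeriv_curl_le hc ⟨K, hKb⟩ hd hm 0
  obtain ⟨D₁, hD₁⟩ := classP_norm_iteratedFDeriv_curl_le hc ⟨K, hKb⟩ hd hm 1
  obtain ⟨D₂, hD₂⟩ := classP_norm_iteratedFDeriv_curl_le hc ⟨K, hKb⟩ hd hm 2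
  have hω0 : ∀ τ < 0, ∀ y, ‖curl (v τ) y‖ ≤ D₀ := fun τ hτ y => by
    have := hD₀ τ hτ y; rwa [norm_iteratedFDeriv_zero] at this
  have hω1 : ∀ τ < 0, ∀ y, ‖fderiv ℝ (curl (v τ)) y‖ ≤ D₁ := fun τ hτ y => by
    have := hD₁ τ hτ y; rwa [norm_iteratedFDeriv_one] at this
  have hω2 : ∀ τ < 0, ∀ y, ‖fderiv ℝ (fderiv ℝ (curl (v τ))) y‖ ≤ D₂ := fun τ hτ y => by
    have := hD₂ τ hτ y
    rwa [← norm_iteratedFDeriv_fderiv, norm_iteratedFDeriv_one] at this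
  have hslice2 : ∀ τ < 0, ContDiff ℝ 2 (curl (v τ)) := fun τ hτ =>
    (hvort.contDiff_slice (mem_Iio.2 hτ)).of_le (by norm_cast)
  -- the datum: the past vorticity slice
  set g : EuclideanSpace ℝ (Fin 3) → EuclideanSpace ℝ (Fin 3) := curl (v s) with hg_def
  have hg2 : ContDiff ℝ 2 g := hslice2 s hs
  have hgc : Continuous g := hg2.continuous
  have hg0 : ∀ z, ‖g z‖ ≤ D₀ := hω0 s hs
  have hg1 : ∀ z, ‖fderiv ℝ g z‖ ≤ D₁ := hω1 s hs
  have hg2' : ∀ z, ‖fderiv ℝ (fderiv ℝ g) z‖ ≤ D₂ := hω2 s hs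
  -- its caloric extension, glued to the datum at `τ = s`
  set G : ℝ → EuclideanSpace ℝ (Fin 3) → EuclideanSpace ℝ (Fin 3) :=
    fun τ y => if s < τ then heatExtension g (τ - s) y else g y with hG_def
  have hG_of_gt : ∀ τ, s < τ → G τ = heatExtension g (τ - s) := fun τ hτ => by
    funext y; simp only [hG_def, if_pos hτ]
  have hGs : G s = g := by funext y; simp only [hG_def, lt_irrefl, if_false]
  have hGbd : ∀ τ y, ‖G τ y‖ ≤ D₀ := by
    intro τ y
    by_cases hτ : s < τ
    · rw [hG_of_gt τ hτ]; exact norm_heatExtension_le hg0 (sub_pos.2 hτ) y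
    · simp only [hG_def, if_neg hτ]; exact hg0 y
  -- joint continuity of the glued extension on `[s, ∞) × ℝ³` (Evans §2.3.1 Thm 1 (i), (iii))
  set θ : ℝ × EuclideanSpace ℝ (Fin 3) → ℝ × EuclideanSpace ℝ (Fin 3) := fun q => (q.1 - s, q.2) with hθ_def
  have hθc : Continuous θ := (continuous_fst.sub continuous_const).prodMk continuous_snd
  have hHc : ContinuousOn (fun q : ℝ × EuclideanSpace ℝ (Fin 3) => heatExtension g q.1 q.2) (Ioi 0 ×ˢ univ) :=
    continuousOn_uncurry_heatExtension hgc hg0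
  have hGcont : ContinuousOn (uncurry G) (Ici s ×ˢ univ) := by
    rintro ⟨τ₀, y₀⟩ hq
    have hτ₀ : s ≤ τ₀ := (mem_prod.1 hq).1
    rcases hτ₀.eq_or_lt with h | h
    · -- the initial time: split the approach region into `{s} × ℝ³` and `(s, ∞) × ℝ³`
      subst h
      have hsplit : Ici s ×ˢ (univ : Set (EuclideanSpace ℝ (Fin 3))) = {s} ×ˢ univ ∪ Ioi s ×ˢ univ := by
        rw [← union_prod, ← Ioi_insert, insert_eq]
      rw [hsplit]
      refine ContinuousWithinAt.union ?_ ?_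
      · -- on the initial slice `G = g`
        have h1 : ContinuousWithinAt (fun q : ℝ × EuclideanSpace ℝ (Fin 3) => g q.2) ({s} ×ˢ univ) (s, y₀) :=
          (hgc.comp continuous_snd).continuousWithinAt
        refine h1.congr (fun q hq' => ?_) ?_
        · obtain ⟨hq1, -⟩ := mem_prod.1 hq'
          have hq1' : q.1 = s := hq1
          show G q.1 q.2 = g q.2
          rw [hq1', hGs]
        · show G s y₀ = g y₀
          rw [hGs]
      · -- from later times: Evans' continuity of the caloric extension at `t = 0⁺`
        have hT := tendsto_heatExtension_nhdsWithin_prod hgc hg0 y₀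
        have hθw : ContinuousWithinAt θ (Ioi s ×ˢ univ) (s, y₀) := hθc.continuousWithinAt
        have hmaps : MapsTo θ (Ioi s ×ˢ univ) (Ioi (0 : ℝ) ×ˢ univ) := fun q hq' =>
          mem_prod.2 ⟨show (0 : ℝ) < q.1 - s from sub_pos.2 (mem_prod.1 hq').1, mem_univ _⟩
        have hθ0 : θ (s, y₀) = ((0 : ℝ), y₀) := by simp only [hθ_def, sub_self]
        have hθt : Tendsto θ (𝓝[Ioi s ×ˢ univ] (s, y₀)) (𝓝[Ioi 0 ×ˢ univ] ((0 : ℝ), y₀)) := by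
          have h := hθw.tendsto_nhdsWithin hmaps
          rwa [hθ0] at h
        have hlim : Tendsto ((fun q : ℝ × EuclideanSpace ℝ (Fin 3) => heatExtension g q.1 q.2) ∘ θ)
            (𝓝[Ioi s ×ˢ univ] (s, y₀)) (𝓝 (g y₀)) := hT.comp hθt
        show Tendsto (uncurry G) (𝓝[Ioi s ×ˢ univ] (s, y₀)) (𝓝 (uncurry G (s, y₀)))
        have hval : uncurry G (s, y₀) = g y₀ := by show G s y₀ = g y₀; rw [hGs]
        rw [hval]
        refine hlim.congr' ?_
        filter_upwards [self_mem_nhdsWithin] with q hq'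
        have hq1 : s < q.1 := (mem_prod.1 hq').1
        show ((fun q : ℝ × EuclideanSpace ℝ (Fin 3) => heatExtension g q.1 q.2) ∘ θ) q = G q.1 q.2
        rw [hG_of_gt q.1 hq1]
        simp only [Function.comp_apply, hθ_def]
    · -- interior times: `G` agrees with the jointly continuous extension near `(τ₀, y₀)`
      have hat : ContinuousAt (fun q : ℝ × EuclideanSpace ℝ (Fin 3) => heatExtension g q.1 q.2) (θ (τ₀, y₀)) :=
        hHc.continuousAt ((isOpen_Ioi.prod isOpen_univ).mem_nhds (mem_prod.2 ⟨sub_pos.2 h, mem_univ _⟩))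
      have hF : ContinuousAt ((fun q : ℝ × EuclideanSpace ℝ (Fin 3) => heatExtension g q.1 q.2) ∘ θ) (τ₀, y₀) :=
        ContinuousAt.comp hat hθc.continuousAt
      have hev : ((fun q : ℝ × EuclideanSpace ℝ (Fin 3) => heatExtension g q.1 q.2) ∘ θ) =ᶠ[𝓝 (τ₀, y₀)]
          uncurry G := by
        filter_upwards [(isOpen_lt continuous_const continuous_fst).mem_nhds h] with q hq'
        show ((fun q : ℝ × EuclideanSpace ℝ (Fin 3) => heatExtension g q.1 q.2) ∘ θ) q = G q.1 q.2
        rw [hG_of_gt q.1 hq']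
        simp only [Function.comp_apply, hθ_def]
      exact (hF.congr hev).continuousWithinAt
  -- the window integral of the majorant
  set I : ℝ → ℝ := fun τ => ∫ r in s..τ, φ r with hI_def
  have hI : ∀ τ, HasDerivAt I (φ τ) τ := fun τ =>
    intervalIntegral.integral_hasDerivAt_right (hφc.intervalIntegrable _ _)
      (hφc.stronglyMeasurableAtFilter _ _) hφc.continuousAt
  have hIc : Continuous I := continuous_iff_continuousAt.2 fun τ => (hI τ).continuousAt
  have hIs : I s = 0 := by simp [hI_def]
  have hφ0 : ∀ τ ∈ Icc s t, 0 ≤ φ τ := fun τ hτ => (norm_nonneg _).trans (hφ τ hτ 0)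
  have hI0 : ∀ τ ∈ Icc s t, 0 ≤ I τ := fun τ hτ =>
    intervalIntegral.integral_nonneg hτ.1 fun r hr => hφ0 r ⟨hr.1, hr.2.trans hτ.2⟩
  -- reduction to a scalar comparison in every direction `e`, `‖e‖ ≤ 1`
  suffices key : ∀ e : EuclideanSpace ℝ (Fin 3), ‖e‖ ≤ 1 →
      ⟪e, curl (v t) x - heatExtension g (t - s) x⟫ ≤ I t by
    set w : EuclideanSpace ℝ (Fin 3) := curl (v t) x - heatExtension g (t - s) x with hw
    by_cases hw0 : w = 0
    · rw [hw0, norm_zero]; exact hI0 t ⟨hst.le, le_rfl⟩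
    · have hpos : 0 < ‖w‖ := norm_pos_iff.2 hw0
      have h1 := key (‖w‖⁻¹ • w) (by rw [norm_smul, norm_inv, norm_norm, inv_mul_cancel₀ hpos.ne'])
      rw [real_inner_smul_left, real_inner_self_eq_norm_sq] at h1
      have h2 : ‖w‖⁻¹ * ‖w‖ ^ 2 = ‖w‖ := by field_simp
      rwa [h2] at h1
  intro e he
  -- the comparison function and its time derivative
  set P : ℝ → EuclideanSpace ℝ (Fin 3) → ℝ := fun τ y => ⟪e, curl (v τ) y - G τ y⟫ - I τ with hP_def
  set Pt : ℝ → EuclideanSpace ℝ (Fin 3) → ℝ := fun τ y =>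
    ⟪e, deriv (fun r => curl (v r) y) τ - heatExtension (Δ g) (τ - s) y⟫ - φ τ with hPt_def
  have hmp := le_of_subsolution_linear_drift (T₁ := s) (T₂ := t) (M := 0) (B := D₀ + D₀) (K := 0) le_rfl
    (P := P) (Pₜ := Pt) ?hc ?h2 ?ht ?hsub ?hB ?hM
  · have h := hmp t ⟨hst.le, le_rfl⟩ x
    have hP : P t x = ⟪e, curl (v t) x - heatExtension g (t - s) x⟫ - I t := by
      simp only [hP_def, hG_of_gt t hst]
    rw [hP] at h
    linarith
  case hc =>
    have h1 : ContinuousOn (uncurry (vorticity v)) (Icc s t ×ˢ univ) :=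
      hvort.continuousOn.mono (prod_mono hIcc Subset.rfl)
    have h2 : ContinuousOn (uncurry G) (Icc s t ×ˢ univ) := hGcont.mono (prod_mono Icc_subset_Ici_self Subset.rfl)
    have h3 : ContinuousOn (fun q : ℝ × EuclideanSpace ℝ (Fin 3) => I q.1) (Icc s t ×ˢ univ) :=
      (hIc.comp continuous_fst).continuousOn
    have h4 : ContinuousOn (fun q : ℝ × EuclideanSpace ℝ (Fin 3) => ⟪e, uncurry (vorticity v) q - uncurry G q⟫)
        (Icc s t ×ˢ univ) := continuousOn_const.inner (h1.sub h2)
    refine (h4.sub h3).congr fun q _ => ?_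
    obtain ⟨τ', y'⟩ := q
    simp only [uncurry_apply_pair, Pi.sub_apply, vorticity_apply, hP_def]
  case h2 =>
    intro τ hτ
    have hτ0 : τ < 0 := hIcc ⟨hτ.1.le, hτ.2⟩
    have hH : ContDiff ℝ 2 (heatExtension g (τ - s)) := contDiff_heatExtension_of_bound hgc hg0 (sub_pos.2 hτ.1)
    have h1 : ContDiff ℝ 2 (fun y => ⟪e, curl (v τ) y - heatExtension g (τ - s) y⟫ - I τ) :=
      (contDiff_const.inner ℝ ((hslice2 τ hτ0).sub hH)).sub contDiff_const
    have hPeq : P τ = fun y => ⟪e, curl (v τ) y - heatExtension g (τ - s) y⟫ - I τ := by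
      funext y; simp only [hP_def, hG_of_gt τ hτ.1]
    rw [hPeq]; exact h1
  case ht =>
    intro τ hτ y
    have hτ0 : τ ∈ Iio (0 : ℝ) := hIcc ⟨hτ.1.le, hτ.2⟩
    have hOmt : HasDerivAt (fun r => curl (v r) y) (deriv (fun r => curl (v r) y) τ) τ :=
      hvort.hasDerivAt_timeLine isOpen_Iio hτ0 y
    have hHe : HasDerivAt (fun r => heatExtension g (r - s) y) (heatExtension (Δ g) (τ - s) y) τ := by
      have h := hasDerivAt_heatExtension_time_of_bounded hg2 hg0 hg1 hg2' (sub_pos.2 hτ.1) y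
      exact HasDerivAt.comp_sub_const τ s h
    have hGt : HasDerivAt (fun r => G r y) (heatExtension (Δ g) (τ - s) y) τ := by
      refine hHe.congr_of_eventuallyEq ?_
      filter_upwards [lt_mem_nhds hτ.1] with r hr
      show G r y = heatExtension g (r - s) y
      rw [hG_of_gt r hr]
    have hinner := (hasDerivAt_const τ e).inner ℝ (hOmt.sub hGt)
    have hall := hinner.sub (hI τ)
    refine hall.congr_deriv ?_
    simp only [hPt_def, inner_zero_left, add_zero]
  case hB =>
    intro τ hτ y
    have hτ0 : τ < 0 := hIcc hτ
    have h1 : ⟪e, curl (v τ) y - G τ y⟫ ≤ ‖e‖ * ‖curl (v τ) y - G τ y‖ := real_inner_le_norm _ _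
    have h2 : ‖curl (v τ) y - G τ y‖ ≤ D₀ + D₀ := (norm_sub_le _ _).trans (add_le_add (hω0 τ hτ0 y) (hGbd τ y))
    have h3 : ‖e‖ * ‖curl (v τ) y - G τ y‖ ≤ 1 * (D₀ + D₀) :=
      mul_le_mul he h2 (norm_nonneg _) zero_le_one
    have h4 := hI0 τ hτ
    show ⟪e, curl (v τ) y - G τ y⟫ - I τ ≤ D₀ + D₀
    linarith
  case hM =>
    intro y
    show ⟪e, curl (v s) y - G s y⟫ - I s ≤ 0
    rw [hGs, hIs, hg_def, sub_self, inner_zero_right, sub_zero]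
  case hsub =>
    intro τ hτ y
    have hτ0 : τ < 0 := hIcc ⟨hτ.1.le, hτ.2⟩
    have hτs : 0 < τ - s := sub_pos.2 hτ.1
    have hOm : ContDiff ℝ 2 (curl (v τ)) := hslice2 τ hτ0
    have hH : ContDiff ℝ 2 (heatExtension g (τ - s)) := contDiff_heatExtension_of_bound hgc hg0 hτs
    -- the Laplacian of the slice `P τ`
    set W : EuclideanSpace ℝ (Fin 3) → EuclideanSpace ℝ (Fin 3) :=
      fun y => curl (v τ) y - heatExtension g (τ - s) y with hW_def
    have hW2 : ContDiff ℝ 2 W := hOm.sub hH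
    have hWeq : W = curl (v τ) - heatExtension g (τ - s) := rfl
    have hPτ : P τ = (fun y => (innerSL ℝ e) (W y)) - fun _ => I τ := by
      funext y
      simp only [hP_def, hG_of_gt τ hτ.1, Pi.sub_apply, innerSL_apply_apply, hW_def]
    have hcomp : (fun y => (innerSL ℝ e) (W y)) = (innerSL ℝ e) ∘ W := rfl
    have hΔW : (Δ W) y = (Δ (curl (v τ))) y - heatExtension (Δ g) (τ - s) y := by
      rw [hWeq, ContDiffAt.laplacian_sub hOm.contDiffAt hH.contDiffAt,
        laplacian_heatExtension_of_bounded hg2 hg0 hg1 hg2' hτs y]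
    have hΔP : (Δ (P τ)) y = ⟪e, (Δ (curl (v τ))) y - heatExtension (Δ g) (τ - s) y⟫ := by
      have h1 : ContDiffAt ℝ 2 (fun y => (innerSL ℝ e) (W y)) y :=
        (((innerSL ℝ e).contDiff).comp hW2).contDiffAt
      rw [hPτ, ContDiffAt.laplacian_sub h1 contDiffAt_const, laplacian_const, sub_zero, hcomp,
        ContDiffAt.laplacian_CLM_comp_left hW2.contDiffAt, Function.comp_apply, hΔW, innerSL_apply_apply]
    -- the vorticity equation at `(τ, y)`: `ω' = Dv[ω] + Δω − Dω[v]`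
    have hveq := TypeILiouvilleStrainLedger.classP_vorticity_eq hc ⟨K, hKb⟩ hd hm hτ0 y
    have hωt : deriv (fun r => curl (v r) y) τ =
        (fderiv ℝ (v τ) y (curl (v τ) y) - fderiv ℝ (curl (v τ)) y (v τ y)) + (Δ (curl (v τ))) y := by
      rw [eq_sub_of_add_eq hveq]; abel
    -- the commutator is majorised by `φ`
    have hf : ⟪e, fderiv ℝ (v τ) y (curl (v τ) y) - fderiv ℝ (curl (v τ)) y (v τ y)⟫ ≤ φ τ := by
      refine (real_inner_le_norm _ _).trans ?_
      have h := mul_le_mul he (hφ τ ⟨hτ.1.le, hτ.2⟩ y) (norm_nonneg _) zero_le_one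
      rwa [one_mul] at h
    have hzero : (0 : ℝ) * (1 + ‖y‖) * ‖fderiv ℝ (P τ) y‖ = 0 := by ring
    show Pt τ y ≤ (Δ (P τ)) y + 0 * (1 + ‖y‖) * ‖fderiv ℝ (P τ) y‖
    rw [hzero, add_zero, hΔP]
    simp only [hPt_def]
    rw [hωt, add_sub_assoc, inner_add_right]
    linarith


/-! ## §2 The free part flattens: curl commutes with the caloric extension -/

/-- **THE CALORIC EXTENSION OF A VORTICITY SLICE DECAYS LIKE `a^{−1/2}`.**  For a class-P flow with `‖v‖ ≤ K` and
`s < 0`, `a > 0`: `‖(e^{aΔ} curl v(s))(y)‖ ≤ ‖curl‖ · 2^{3/2} a^{−1/2} K`.  Curl commutes with the caloric extension of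
the bounded `C¹` slice `v(s)` (derivatives fall on bounded data), and `‖∇ e^{aΔ} f‖_∞ ≤ 2^{n/2} a^{−1/2} ‖f‖_∞`
(Giga–Giga–Saal §1.1.3). [cite: GigaGigaSaal2010, §1.1.3] [cite: KochNadirashviliSereginSverak2009, §4 (i) (arXiv:0709.3599)] -/
theorem norm_heatExtension_curl_le
    {v : ℝ → EuclideanSpace ℝ (Fin 3) → EuclideanSpace ℝ (Fin 3)}
    (hc : ContinuousOn (uncurry v) (Iio 0 ×ˢ univ))
    {K : ℝ} (hKb : ∀ t < 0, ∀ x, ‖v t x‖ ≤ K)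
    (hd : ∀ t < 0, IsWeaklyDivFree (v t))
    (hm : ∀ s t : ℝ, s < t → t < 0 → ∀ x,
      v t x = heatExtension (v s) (t - s) x - oseenDuhamel 1 s v v t x)
    {s : ℝ} (hs : s < 0) {a : ℝ} (ha : 0 < a) (y : EuclideanSpace ℝ (Fin 3)) :
    ‖heatExtension (curl (v s)) a y‖ ≤
      ‖curlCLM‖ * ((2 : ℝ) ^ ((Module.finrank ℝ (EuclideanSpace ℝ (Fin 3)) : ℝ) / 2) * a ^ (-(1 / 2 : ℝ)) * K) := by
  obtain ⟨hsm', hbounds⟩ := smooth_and_bounds_of_bounded_ancient_oseenMild hc hd hm hKb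
  have hsm : IsSmoothSpaceTimeOn (Iio 0) v := hsm'
  obtain ⟨C₁, hC₁⟩ := hbounds 1
  have hvs : ContDiff ℝ 1 (v s) := (hsm.contDiff_slice (mem_Iio.2 hs)).of_le (by norm_cast)
  have hvc : Continuous (v s) := hvs.continuous
  have hDc : Continuous (fderiv ℝ (v s)) := hvs.continuous_fderiv one_ne_zero
  have hD1 : ∀ z, ‖fderiv ℝ (v s) z‖ ≤ C₁ := fun z => by
    have := hC₁ s hs z; rwa [norm_iteratedFDeriv_one] at this
  -- derivatives fall on the bounded `C¹` slice
  have h2 : heatExtension (fderiv ℝ (v s)) a y = fderiv ℝ (heatExtension (v s) a) y := by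
    refine ContinuousLinearMap.ext fun w => ?_
    have hb : ∀ z, ‖fderiv ℝ (v s) z w‖ ≤ C₁ * ‖w‖ := fun z =>
      (ContinuousLinearMap.le_opNorm _ _).trans (mul_le_mul_of_nonneg_right (hD1 z) (norm_nonneg _))
    rw [fderiv_heatExtension_apply_of_bounded hvs (hKb s hs) hb ha y]
    have h3 := heatExtension_clm_comp_of_bound
      (ContinuousLinearMap.apply ℝ (EuclideanSpace ℝ (Fin 3)) w) hDc hD1 ha y
    simp only [ContinuousLinearMap.apply_apply] at h3
    exact h3.symm
  -- curl commutes with the caloric extension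
  have hce : curl (v s) = fun z => curlCLM (fderiv ℝ (v s) z) := rfl
  have h1 : heatExtension (fun z => curlCLM (fderiv ℝ (v s) z)) a y = curlCLM (heatExtension (fderiv ℝ (v s)) a y) :=
    heatExtension_clm_comp_of_bound curlCLM hDc hD1 ha y
  rw [hce, h1, h2]
  calc ‖curlCLM (fderiv ℝ (heatExtension (v s) a) y)‖
      ≤ ‖curlCLM‖ * ‖fderiv ℝ (heatExtension (v s) a) y‖ := ContinuousLinearMap.le_opNorm _ _
    _ ≤ ‖curlCLM‖ * ((2 : ℝ) ^ ((Module.finrank ℝ (EuclideanSpace ℝ (Fin 3)) : ℝ) / 2) * a ^ (-(1 / 2 : ℝ)) * K) :=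
        mul_le_mul_of_nonneg_left
          (norm_fderiv_heatExtension_le_of_bounded hvc.aestronglyMeasurable (hKb s hs) ha y) (norm_nonneg curlCLM)

end Summit.NavierStokesRegularity.NavierStokesRegularity.Theorems.TypeILiouvilleLambTail

end
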